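/-
Copyright (c) 2026. All rights reserved.
Released under Apache 2.0 license as described in the file LICENSE.
Authors: abc-iut cell, seat abc-iut-L4-t10 (gen 4; block W2-B4 model column, node `AbsTopIII:Cor4.5(iii)`:
the cores half of the compatibility clause of (iii) at the archimedean models, zero binders).
-/
import Literature.AnabelianGeometry.AbsoluteAnabelian.AbsTopIII.FrobeniusPictureMLFLogGlueCrossClosure
import Literature.AnabelianGeometry.AbsoluteAnabelian.AbsTopIII.FrobeniusPictureMLFShiftTelecoreCompatible
import Literature.AnabelianGeometry.AbsoluteAnabelian.AbsTopIII.AutHolLogFrobeniusCompatibility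
import Literature.AnabelianGeometry.AbsoluteAnabelian.AbsTopIII.AutHolLogFrobeniusModelProofs
import Literature.AnabelianGeometry.AbsoluteAnabelian.AbsTopIII.AutHolLogFrobeniusGaloisModel
import Literature.AnabelianGeometry.AbsoluteAnabelian.ArchimedeanLogFrobeniusModelTM
import Literature.AnabelianGeometry.AbsoluteAnabelian.ArchimedeanHolFieldFunctorGeometricRC
import Literature.AnabelianGeometry.AbsoluteAnabelian.AbsTopIII.AutHolLogFrobeniusModelIotaProofs
import HarnessLib

/-!
# [AbsTopIII] Cor 4.5 (iii), second clause, CORES half — ONE family of homotopies on `𝒟` containing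
# the `𝔖_log` family and the core families of (i) — DISCHARGED at the archimedean models with NO
# residual hypothesis

S. Mochizuki, *Topics in Absolute Anabelian Geometry III*, Cor 4.5 (iii) p. 109 l. 2–5 (kurims
manuscript, lit key `paper:url-5493eb38cbb7`, read on the page; bib key `MochizukiAbsTopIII2015`): the
family of homotopies of the observable `𝔖_log` "is compatible with the families of homotopies that
constitute the core and telecore structures of (i), (ii)".  Printed proof, p. 110: "immediate from the
definitions" (as Cor 3.6 (iii), p. 81).  Seat abc-iut-L4-t10 typed the clause as
`AbsTopIII.Cor_4_5_iii_compat Δ τ := Δ.LogObsCompatCoresStmt ∧ Δ.LogObsCompatTelecoreStmt τ`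
(`AutHolLogFrobeniusCompatibility.lean`; abc-iut-L4-t5's literal Def 3.5 (ii) statements, imported, never
restated).  PROOF-ONLY file (no notion is declared).

State of the tree before this file.  The CORES half `LogObsCompatCoresStmt` (ONE family on `𝒟` — the
master family — containing the `𝔖_log` family along `𝒟_{≤3} ↪ 𝒟` and core families for `(𝒟_{≤4}, ℰ)`,
`(𝒟_{≤5}, 𝒜)`, `(𝒟_{≤6}, ℰ)`) has been REDUCED by the cell, over ABSTRACT data, to the content statement
`IotaOverGaloisStmt` (F-0360: `ι_×`, `ι_{log,⋎}` lie over `ℰ`):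
abc-iut-w4-d095's `observableLogStmt` (the `𝔖_log` family `H₃` exists for every `Δ`),
abc-iut-w5-d053's `logObsCompatCoresStmt_of_imageCross` (p432316: master family `glueFamily`, reduction
to the image form of the cross-term identity), `imageCross_of_generators` (p433228: extension from the
generator pairs over `Sat(LogGen)`) and `generatorCross_of_iotaOverGalois` (p437037: the generator
identity (G) FROM `IotaOverGaloisStmt`), assembled as `logObsCompatCoresStmt_of_iotaOverGaloisStmt :
Δ.IotaOverGaloisStmt → Δ.LogObsCompatCoresStmt` (p437324, with the `TF`-model instance
`TFModel.logObsCompatCoresStmt_model`).  At the archimedean model `𝒳 = 𝒞^hol_TF` the content statement is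
abc-iut-L4-t10 gen 3's `arch_iotaOverGaloisStmt` (p427358): `ι_×`, `ι_log` act on arithmetic data only;
the archimedean models were not instantiated.

This file:

* `AbsTopIII.archTM_iotaOverGaloisStmt` — NEW model input: `IotaOverGaloisStmt` at the `TM` model
  `archLogFrobeniusDataTM 𝔄` (abc-iut-w5-d226's `ι_log^{TM}`, `ι_×^{TM}` = the `TF` ones whiskered along
  `𝔩𝔬𝔤_{TM,TF}`, and `𝔩𝔬𝔤_{TM,TM} ≅ 𝟭` with components over `id_𝕏`: all structure-orbispace components
  are identities), proved exactly as gen 3's `arch_iotaOverGaloisStmt`.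
* `AbsTopIII.cor_4_5_iii_compatCores_arch`, `…_arch_TM` — **the cores half of Cor 4.5 (iii)'s
  compatibility clause at BOTH archimedean models for EVERY interface datum `𝔄`, ZERO binders**; and the
  zero-binder corollaries at the constant-field data, the Galois categories `B(Π)` (no slimness input),
  and the geometric carriers `EA^hol_RS(Q)` / `RC(Q)` (no id-rigidity / Lemma-4.3 input).
* `AbsTopIII.cor_4_5_iii_compat_arch_of_telecore`, `cor_4_5_full_arch_of_telecore`,
  `cor_4_5_full_arch_iff_telecore` — bookkeeping: at the arch model the (iii) clause now needs only its
  TELECORE half (`LogObsCompatTelecoreStmt`, abc-iut-w6-d025's row «LogObsCompatTelecore»), and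
  `Cor_4_5_full` (all printed clauses) holds iff `LogObsCompatTelecoreStmt ∧ ShiftCompatStmt`, given
  `𝕏₀ : EA` and `IsIdRigid EA` — the two inputs still open at the archimedean model, by name.

HONEST SCOPE: model-level ≠ node-level ≠ reconstruction; the models' `𝒩` is `𝒞^hol_TH` restricted to
arithmetic data inside CAFs (scope note of `ArchimedeanLogFrobeniusModel.lean`).  Refereed pre-IUT
anabelian geometry; nothing here bears on [IUTchIII] Cor. 3.12 or takes a side; typed ≠ proved.
-/

namespace Literature.AnabelianGeometry.AbsoluteAnabelian

open _root_.CategoryTheory _root_.Quiver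

universe u

namespace AbsTopIII

/-! ### `IotaOverGaloisStmt` at the `TM` model -/

/-- A morphism between propositionally equal objects that is heterogeneously the identity is the
`eqToHom` (bookkeeping; private copy of gen 3's helper). [folklore] -/
private theorem eq_eqToHom_of_heq_id'' {C : Type*} [Category C] {a b : C} (h : a = b) (f : a ⟶ b)
    (hf : HEq f (𝟙 a)) : f = eqToHom h := by
  cases h
  simpa using hf

/-- `f = eqToHom ≫ m ≫ eqToHom` for morphisms between propositionally equal objects that are
heterogeneously identities (bookkeeping; private copy of gen 3's helper). [folklore] -/
private theorem eq_eqToHom_comp_of_heq_id'' {C : Type*} [Category C] {a b c d : C} (h₁ : a = b)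
    (h₃ : b = c) (h₂ : c = d) (f : a ⟶ d) (m : b ⟶ c) (hm : HEq m (𝟙 b)) (hf : HEq f (𝟙 a)) :
    f = eqToHom h₁ ≫ m ≫ eqToHom h₂ := by
  cases h₁
  cases h₃
  cases h₂
  have hm' : m = 𝟙 _ := eq_of_heq hm
  have hf' : f = 𝟙 _ := eq_of_heq hf
  subst hm' hf'
  simp

variable (𝔄 : AutHolFieldFunctor.{u})

/-- At the `TM` model the structure-orbispace component of `ι_×^{TM}` at every pair is the identity
(`ι_×^{TM}` is `ι_×` whiskered along `𝔩𝔬𝔤_{TM,TF}`). [cite: MochizukiAbsTopIII2015, Corollary 4.5 (iii) p.109] -/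
theorem archTM_NtoE_map_iotaTimesTM (x : HolMonoidPair 𝔄 .TM) :
    (HolTHPair.toEA 𝔄).map ((HolMonoidPair.iotaTimesTM 𝔄).app x) =
      𝟙 ((HolMonoidPair.logTMTF 𝔄).obj x).X := rfl

/-- At the `TM` model the structure-orbispace component of `ι_log^{TM}` at every pair is the identity.
[cite: MochizukiAbsTopIII2015, Corollary 4.5 (iii) p.109] -/
theorem archTM_NtoE_map_iotaLogTM (x : HolMonoidPair 𝔄 .TM) :
    (HolTHPair.toEA 𝔄).map ((HolMonoidPair.iotaLogTM 𝔄).app x) =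
      𝟙 ((HolMonoidPair.logTMTF 𝔄).obj x).X := rfl

/-- At the `TM` model the structure-orbispace component of Prop 4.2 (ii)'s `𝔩𝔬𝔤_{TM,TM} ≅ 𝟭` at every
pair is the identity `id_𝕏`. [cite: MochizukiAbsTopIII2015, Proposition 4.2 (ii) p.106] -/
theorem archTM_XtoE_map_logTMIsoId (x : HolMonoidPair 𝔄 .TM) :
    (HolMonoidPair.toEA 𝔄 .TM).map ((HolMonoidPair.logTMIsoId 𝔄).hom.app x) = 𝟙 x.X := rfl

/-- **[AbsTopIII] Cor 4.5 (iii), second clause — CONTENT, AT THE ARCHIMEDEAN `TM` MODEL**: for the input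
data `archLogFrobeniusDataTM 𝔄` (`𝒳 = 𝒞^hol_TM`) over any interface datum `𝔄`, the natural
transformations `ι_×^{TM}` and `ι_{log}^{TM}` lie over `ℰ = EA` (abc-iut-L4-t5's `IotaOverGaloisStmt`):
all structure-orbispace components, including those of `𝔩𝔬𝔤_{TM,TM} ≅ 𝟭`, are identities, and
`id_⋎ = 𝟭`.  The `TM` twin of gen 3's `arch_iotaOverGaloisStmt`.
[cite: MochizukiAbsTopIII2015, Corollary 4.5 (iii) p.109] -/
theorem archTM_iotaOverGaloisStmt : (archLogFrobeniusDataTM 𝔄).IotaOverGaloisStmt := by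
  refine ⟨?_, ?_⟩
  · show ∀ x : HolMonoidPair 𝔄 .TM,
      (HolTHPair.toEA 𝔄).map ((HolMonoidPair.iotaTimesTM 𝔄).app x) = eqToHom _
    intro x
    exact eq_eqToHom_of_heq_id'' _ _ (heq_of_eq (archTM_NtoE_map_iotaTimesTM 𝔄 x))
  · intro x
    exact eq_eqToHom_comp_of_heq_id'' _ rfl _ _ _ (heq_of_eq (archTM_XtoE_map_logTMIsoId 𝔄 x))
      (heq_of_eq (archTM_NtoE_map_iotaLogTM 𝔄 x))

/-! ### The cores half of (iii)'s compatibility clause at the archimedean models, zero binders -/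

/-- **[AbsTopIII] Cor 4.5 (iii), second clause, CORES half, at the archimedean MODEL `𝒳 = 𝒞^hol_TF` for
EVERY interface datum `𝔄 : AutHolFieldFunctor`, with NO further hypothesis**: one family of homotopies
on `𝒟` contains the `𝔖_log` family and the core families of (i) (`LogObsCompatCoresStmt`) —
abc-iut-w5-d053's `logObsCompatCoresStmt_of_iotaOverGaloisStmt` fed with gen 3's `arch_iotaOverGaloisStmt`
("immediate from the definitions": `ι_×`, `ι_log` act on arithmetic data only). [cite: MochizukiAbsTopIII2015, Corollary 4.5 (iii) p.109] -/
theorem cor_4_5_iii_compatCores_arch : (archLogFrobeniusData 𝔄).LogObsCompatCoresStmt :=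
  (archLogFrobeniusData 𝔄).logObsCompatCoresStmt_of_iotaOverGaloisStmt (arch_iotaOverGaloisStmt 𝔄)

/-- **[AbsTopIII] Cor 4.5 (iii), second clause, CORES half, at the archimedean MODEL `𝒳 = 𝒞^hol_TM`**
("where `T ∈ {TM, TF}`"), every `𝔄`, zero binders. [cite: MochizukiAbsTopIII2015, Corollary 4.5 (iii) p.109] -/
theorem cor_4_5_iii_compatCores_arch_TM : (archLogFrobeniusDataTM 𝔄).LogObsCompatCoresStmt :=
  (archLogFrobeniusDataTM 𝔄).logObsCompatCoresStmt_of_iotaOverGaloisStmt (archTM_iotaOverGaloisStmt 𝔄)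

/-- Cores half of Cor 4.5 (iii)'s compatibility clause at the archimedean model over EVERY constant-field
datum `EA := E`, zero binders. [cite: MochizukiAbsTopIII2015, Corollary 4.5 (iii) p.109] -/
theorem cor_4_5_iii_compatCores_ofConstField (E : Type 1) [Category.{1} E] :
    (archLogFrobeniusData (AutHolFieldFunctor.ofConstField E)).LogObsCompatCoresStmt :=
  cor_4_5_iii_compatCores_arch _

/-- **Cores half of Cor 4.5 (iii)'s compatibility clause at the Galois-category instance `EA = B(Π)` for
EVERY topological group `Π`, with NO slimness hypothesis.** [cite: MochizukiAbsTopIII2015, Corollary 4.5 (iii) p.109] -/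
theorem cor_4_5_iii_compatCores_ofGaloisCategory (G : Type) [Group G] [TopologicalSpace G] :
    (archLogFrobeniusData (AutHolFieldFunctor.ofGaloisCategory G)).LogObsCompatCoresStmt :=
  cor_4_5_iii_compatCores_arch _

/-! ### Assembly at the model: what remains of (iii) and of the full corollary -/

/-- **Cor 4.5 (iii), second clause at the archimedean model, GIVEN its telecore half**
(`AbsTopIII.Cor_4_5_iii_compat = LogObsCompatCoresStmt ∧ LogObsCompatTelecoreStmt`): the cores half is no
longer an input. [cite: MochizukiAbsTopIII2015, Corollary 4.5 (iii) p.109] -/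
theorem cor_4_5_iii_compat_arch_of_telecore
    (ht : (archLogFrobeniusData 𝔄).LogObsCompatTelecoreStmt (archTelecoreData 𝔄)) :
    Cor_4_5_iii_compat (archLogFrobeniusData 𝔄) (archTelecoreData 𝔄) :=
  ⟨cor_4_5_iii_compatCores_arch 𝔄, ht⟩

/-- The same at the `TM` model. [cite: MochizukiAbsTopIII2015, Corollary 4.5 (iii) p.109] -/
theorem cor_4_5_iii_compat_arch_TM_of_telecore
    (ht : (archLogFrobeniusDataTM 𝔄).LogObsCompatTelecoreStmt (archTelecoreDataTM 𝔄)) :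
    Cor_4_5_iii_compat (archLogFrobeniusDataTM 𝔄) (archTelecoreDataTM 𝔄) :=
  ⟨cor_4_5_iii_compatCores_arch_TM 𝔄, ht⟩

/-- **Corollary 4.5 with ALL its printed clauses at the archimedean model `𝒳 = 𝒞^hol_TF`, from what now
remains open there**: `𝕏₀ : EA` and `IsIdRigid EA` (items (i)–(v), `cor_4_5_arch`), the TELECORE half of
the (iii) clause (`LogObsCompatTelecoreStmt`, row «LogObsCompatTelecore») and the third sentence of (v)
(`ShiftCompatStmt`, row «Cor36-SHIFT») — by name; the cores half of (iii) and the fourth sentence of (v)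
are supplied by this file and by abc-iut-w6-d025's `shiftTelecoreCompatStmt_of_coherent` at the model (the
term of `cor_4_5_v_shiftTelecoreCompat_arch`, `AutHolLogFrobeniusCor45vCompatModelProofs.lean`, inlined so that
this file does not wait on that module's olean).  Bookkeeping only.
[cite: MochizukiAbsTopIII2015, Corollary 4.5 pp.107–109] -/
theorem cor_4_5_full_arch_of_telecore (X₀ : 𝔄.EA) (hE : IsIdRigid 𝔄.EA)
    (ht : (archLogFrobeniusData 𝔄).LogObsCompatTelecoreStmt (archTelecoreData 𝔄))
    (h₃ : (archLogFrobeniusData 𝔄).ShiftCompatStmt) :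
    Cor_4_5_full (archLogFrobeniusData 𝔄) (archTelecoreData 𝔄) :=
  ⟨cor_4_5_arch 𝔄 X₀ hE, cor_4_5_iii_compat_arch_of_telecore 𝔄 ht, h₃,
    (archLogFrobeniusData 𝔄).shiftTelecoreCompatStmt_of_coherent (archTelecoreData 𝔄)
      (Functor.FullyFaithful.id (HolTFPair 𝔄)) (arch_telecore_coherent 𝔄)⟩

/-- At the archimedean model the full corollary reduces to EXACTLY `𝕏₀ : EA`, `IsIdRigid EA`, the
telecore half of the (iii) clause and sentence 3 of (v); conversely the full form returns the last two.
[cite: MochizukiAbsTopIII2015, Corollary 4.5 pp.107–109] -/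
theorem cor_4_5_full_arch_iff_telecore (X₀ : 𝔄.EA) (hE : IsIdRigid 𝔄.EA) :
    Cor_4_5_full (archLogFrobeniusData 𝔄) (archTelecoreData 𝔄) ↔
      (archLogFrobeniusData 𝔄).LogObsCompatTelecoreStmt (archTelecoreData 𝔄) ∧
        (archLogFrobeniusData 𝔄).ShiftCompatStmt :=
  ⟨fun h => ⟨h.2.1.2, h.2.2.1⟩, fun h => cor_4_5_full_arch_of_telecore 𝔄 X₀ hE h.1 h.2⟩

end AbsTopIII

namespace HolRS

/-- **Cores half of Cor 4.5 (iii)'s compatibility clause at the GEOMETRIC model for EVERY object property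
`Q` of connected Riemann surfaces** (`EA = EA^hol_RS(Q)`, abc-iut-L4-t14's `geometricAutHolFieldFunctor Q`;
in particular print's elliptically admissible hyperbolic orbicurves), with NO id-rigidity / Lemma-4.3
input. [cite: MochizukiAbsTopIII2015, Corollary 4.5 (iii) p.109] -/
theorem cor_4_5_iii_compatCores_geometric (Q : ObjectProperty HolRS) :
    (archLogFrobeniusData (geometricAutHolFieldFunctor Q)).LogObsCompatCoresStmt :=
  AbsTopIII.cor_4_5_iii_compatCores_arch _

/-- **Cores half of Cor 4.5 (iii)'s compatibility clause at the RC-holomorphic geometric model**, every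
`Q`, zero binders. [cite: MochizukiAbsTopIII2015, Corollary 4.5 (iii) p.109] -/
theorem cor_4_5_iii_compatCores_geometricRC (Q : ObjectProperty RC) :
    (archLogFrobeniusData (geometricAutHolFieldFunctorRC Q)).LogObsCompatCoresStmt :=
  AbsTopIII.cor_4_5_iii_compatCores_arch _

end HolRS

end Literature.AnabelianGeometry.AbsoluteAnabelian
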